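import Mathlib
import Literature.Analysis.FluidPDE.VectorCalculus

/-!
# Integrability of the regularised Biot–Savart kernel along a proper filament

Tools stub `stub_kernelIntegrable` of line `Sketch` (crux `SkeletonEquilibrium`, thesis
`FilamentSkeletonRss`). For the Rosenhead-regularised Biot–Savart law with core parameter `e ≠ 0`
and a `C¹` curve `X : ℝ → ℝ³` with `‖X′‖ ≤ 1` which is proper with linear growth,
`c |u| − C ≤ ‖X u‖` (`c > 0`), the integrand
`u ↦ ((‖y − X u‖² + e²)^{3/2})⁻¹ • X′(u) × (y − X u)` is Bochner integrable on `ℝ` at every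
point `y`.

Proof: the integrand is continuous (`X`, `X′` continuous, the base `‖y − X u‖² + e² ≥ e² > 0`,
the cross product is the continuous bilinear map `crossCLM`), and with `r = ‖y − X u‖`,
`b = r² + e²` its norm is at most `r / b^{3/2} = r / (b √b) ≤ 1 / b` (as `r ≤ √b`). The linear
growth gives `c |u| ≤ r + K` with `K = |C| + ‖y‖`, whence `c² u² ≤ 2 r² + 2 K²` and
`1 / b ≤ M / (1 + u²)` with `M = (2 e² + c² + 2 K²) / (c² e²)`; domination by the integrable
`M (1 + u²)⁻¹` (`integrable_inv_one_add_sq`) concludes.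
-/

noncomputable section

open MeasureTheory Filter Topology
open Literature.Analysis.FluidPDE

namespace Summit.NavierStokesRegularity.NavierStokesRegularity.Theorems.SkeletonEquilibrium.Sketch
set_option linter.dupNamespace false

/-- `‖v × w‖ ≤ ‖v‖ ‖w‖` (from `norm_cross`, `sin ≤ 1`). [folklore] -/
private theorem rosenhead_norm_cross_le (v w : EuclideanSpace ℝ (Fin 3)) :
    ‖cross v w‖ ≤ ‖v‖ * ‖w‖ := by
  rw [norm_cross]
  exact mul_le_of_le_one_right (by positivity) (Real.sin_le_one _)

/-- `b ^ (3/2) = b √b` for `0 < b`. [folklore] -/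
private theorem rosenhead_rpow_three_halves {b : ℝ} (hb : 0 < b) :
    b ^ (3 / 2 : ℝ) = b * Real.sqrt b := by
  rw [show (3 / 2 : ℝ) = 1 + 1 / 2 by norm_num, Real.rpow_add hb, Real.rpow_one, Real.sqrt_eq_rpow]

/-- The scalar kernel bound `r / (r² + e²)^{3/2} ≤ (r² + e²)⁻¹` for `e ≠ 0`
(since `r ≤ √(r² + e²)`). [folklore] -/
private theorem rosenhead_kernel_mul_le_inv (r : ℝ) {e : ℝ} (he : e ≠ 0) :
    ((r ^ 2 + e ^ 2) ^ (3 / 2 : ℝ))⁻¹ * r ≤ (r ^ 2 + e ^ 2)⁻¹ := by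
  have hb : 0 < r ^ 2 + e ^ 2 := by positivity
  have hs : 0 < Real.sqrt (r ^ 2 + e ^ 2) := Real.sqrt_pos.2 hb
  rw [rosenhead_rpow_three_halves hb, mul_inv, mul_assoc]
  refine mul_le_of_le_one_right (inv_nonneg.2 hb.le) ?_
  rw [inv_mul_le_iff₀ hs, mul_one]
  exact Real.le_sqrt_of_sq_le (by nlinarith [sq_nonneg e])

/-- Linear growth turns `(r² + e²)⁻¹` into an `O((1 + u²)⁻¹)` bound: if `c |u| ≤ r + K` with
`c > 0`, `e ≠ 0`, then `(r² + e²)⁻¹ ≤ M (1 + u²)⁻¹` with `M = (2 e² + c² + 2 K²) / (c² e²)`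
(from `c² u² ≤ (r + K)² ≤ 2 r² + 2 K²`). [folklore] -/
private theorem rosenhead_inv_le_const_mul_inv_one_add_sq {r e c K u : ℝ} (he : e ≠ 0)
    (hc : 0 < c) (hK : c * |u| ≤ r + K) :
    (r ^ 2 + e ^ 2)⁻¹ ≤ (2 * e ^ 2 + c ^ 2 + 2 * K ^ 2) / (c ^ 2 * e ^ 2) * (1 + u ^ 2)⁻¹ := by
  have hb : 0 < r ^ 2 + e ^ 2 := by positivity
  have he2 : 0 < e ^ 2 := by positivity
  have hc2 : 0 < c ^ 2 := by positivity
  have hu : 0 < 1 + u ^ 2 := by positivity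
  have h1 : c ^ 2 * u ^ 2 ≤ 2 * r ^ 2 + 2 * K ^ 2 := by
    have h0 : 0 ≤ c * |u| := by positivity
    have h := pow_le_pow_left₀ h0 hK 2
    rw [mul_pow, sq_abs] at h
    nlinarith [sq_nonneg (r - K)]
  rw [inv_eq_one_div, inv_eq_one_div, div_mul_div_comm, mul_one,
    div_le_div_iff₀ hb (by positivity)]
  nlinarith [mul_le_mul_of_nonneg_left h1 he2.le, sq_nonneg (e ^ 2),
    mul_nonneg hc2.le (sq_nonneg r), mul_nonneg (sq_nonneg K) (sq_nonneg r)]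

/-- **Tools stub** (`stub_kernelIntegrable`): for `e ≠ 0`, `c > 0` and a `C¹` curve
`X : ℝ → ℝ³` with `‖X′‖ ≤ 1` and linear growth `c |u| − C ≤ ‖X u‖`, the regularised Biot–Savart
integrand `u ↦ ((‖y − X u‖² + e²)^{3/2})⁻¹ • X′(u) × (y − X u)` is Bochner integrable on `ℝ` at
every point `y` (continuity plus domination by `M (1 + u²)⁻¹`). [folklore] -/
theorem stub_kernelIntegrable : ∀ (e c C : ℝ) (X : ℝ → EuclideanSpace ℝ (Fin 3)), e ≠ 0 → 0 < c → ContDiff ℝ 1 X → (∀ u, ‖deriv X u‖ ≤ 1) → (∀ u, c * |u| - C ≤ ‖X u‖) → ∀ y : EuclideanSpace ℝ (Fin 3), MeasureTheory.Integrable (fun u : ℝ => ((‖y - X u‖ ^ 2 + e ^ 2) ^ (3 / 2 : ℝ))⁻¹ • Literature.Analysis.FluidPDE.cross (deriv X u) (y - X u)) := by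
  intro e c C X he hc hX hdX hgrow y
  have hXc : Continuous X := hX.continuous
  have hdc : Continuous (deriv X) := hX.continuous_deriv le_rfl
  have hb : ∀ u : ℝ, 0 < ‖y - X u‖ ^ 2 + e ^ 2 := fun u => by positivity
  have hsc : Continuous fun u : ℝ => ((‖y - X u‖ ^ 2 + e ^ 2) ^ (3 / 2 : ℝ))⁻¹ :=
    ((((continuous_const.sub hXc).norm.pow 2).add continuous_const).rpow_const
      fun u => Or.inr (by norm_num)).inv₀ fun u => (Real.rpow_pos_of_pos (hb u) _).ne'
  have hcr : Continuous fun u : ℝ => cross (deriv X u) (y - X u) :=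
    (crossCLM.continuous.comp hdc).clm_apply (continuous_const.sub hXc)
  have hcont : Continuous fun u : ℝ =>
      ((‖y - X u‖ ^ 2 + e ^ 2) ^ (3 / 2 : ℝ))⁻¹ • cross (deriv X u) (y - X u) := hsc.smul hcr
  refine (integrable_inv_one_add_sq.const_mul
    ((2 * e ^ 2 + c ^ 2 + 2 * (|C| + ‖y‖) ^ 2) / (c ^ 2 * e ^ 2))).mono'
    hcont.aestronglyMeasurable (Eventually.of_forall fun u => ?_)
  rw [norm_smul, norm_inv, Real.norm_of_nonneg (Real.rpow_nonneg (hb u).le _)]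
  have hr : c * |u| ≤ ‖y - X u‖ + (|C| + ‖y‖) := by
    have h1 := hgrow u
    have h2 : ‖X u‖ - ‖y‖ ≤ ‖y - X u‖ := by
      rw [norm_sub_rev]
      exact norm_sub_norm_le _ _
    have h3 : C ≤ |C| := le_abs_self C
    linarith
  calc ((‖y - X u‖ ^ 2 + e ^ 2) ^ (3 / 2 : ℝ))⁻¹ * ‖cross (deriv X u) (y - X u)‖
      ≤ ((‖y - X u‖ ^ 2 + e ^ 2) ^ (3 / 2 : ℝ))⁻¹ * ‖y - X u‖ := by
        refine mul_le_mul_of_nonneg_left ?_ (inv_nonneg.2 (Real.rpow_nonneg (hb u).le _))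
        calc ‖cross (deriv X u) (y - X u)‖ ≤ ‖deriv X u‖ * ‖y - X u‖ :=
              rosenhead_norm_cross_le _ _
          _ ≤ 1 * ‖y - X u‖ := mul_le_mul_of_nonneg_right (hdX u) (norm_nonneg _)
          _ = ‖y - X u‖ := one_mul _
    _ ≤ (‖y - X u‖ ^ 2 + e ^ 2)⁻¹ := rosenhead_kernel_mul_le_inv _ he
    _ ≤ (2 * e ^ 2 + c ^ 2 + 2 * (|C| + ‖y‖) ^ 2) / (c ^ 2 * e ^ 2) * (1 + u ^ 2)⁻¹ :=
        rosenhead_inv_le_const_mul_inv_one_add_sq he hc hr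

end Summit.NavierStokesRegularity.NavierStokesRegularity.Theorems.SkeletonEquilibrium.Sketch
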